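import Mathlib
import HarnessLib
import Literature.MathematicalPhysics.QuantumLattice.DuhamelEqualTimeBounds
import Literature.MathematicalPhysics.QuantumLattice.ApproximatingHamiltonianProofs
import Summits.HubbardSuperconductivity.HubbardSuperconductivity.Theorems.BalabanIRBirGappedPhaseReductionRLogic
import Summits.HubbardSuperconductivity.HubbardSuperconductivity.Theorems.ThermalWedgeTwSeededRungSectorGibbs

/-!
# BalabanIR reduction `BirGappedPhaseReductionR` (stmt-14846): the sector-Duhamel transfer, typed correctly

Support file (`--supports stmt-HubbardSuperconductivity-14846`; prover seat 2, session 10).  The two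
Hubbard–Stratonovich cards of the crux's second ideation round (`form-factor-hs-ward-transfer`, typed
transfer target C⁺_A `SectorDuhamelPairOrder`; `slaved-pair-field-os-dictionary`, step (4)) deliver a
TIME-AVERAGED (Duhamel / two-time) canonical-sector pair correlation of the pair field `Δ_d`, and both
intend to pass to the EQUAL-TIME sector correlation `tr(P_S e^{−βH} Δ_dᴴΔ_d)` that the landed endgame
(`Theorems.dWaveGroundStateAverageLRO_of_frequently_thermal`) consumes.  Because `Δ_d` CHANGES the sector
(`N ↦ N − 2`), the Duhamel → equal-time inequality in a sector (Literature
`re_integral_trace_proj_duhamel_le`, DLS 1978 `b ≤ g` for a general observable) carries a second term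
living in the IMAGE sector, `tr(e^{−βH} Δ_d P_S Δ_dᴴ)` — not the commutator `[Δ_d, Δ_dᴴ]`.  This file types
the transfer with that term made explicit:

* `sector_equalTime_ge_of_duhamel_of_removalCost` — abstract finite-dimensional step: for Hermitian
  `H`, an idempotent Hermitian `P` commuting with `H`, any `B`, at one `β` with `Re tr(P e^{−βH}) > 0`:
  `c₁ ≤ Duh_P(Bᴴ,B)/Z_P` and `Re tr(e^{−βH} B P Bᴴ) ≤ c₂ Z_P` give
  `2c₁ − c₂ ≤ Re( tr(P e^{−βH} BᴴB) / tr(P e^{−βH}) )`.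
* `frequentlyThermal_of_sectorDuhamel` — Hubbard instance in the route's frame: (C⁺_A-shaped sector
  Duhamel `d`-wave pair order `≥ c L⁴` frequently in `β`) ∧ (PAIR-REMOVAL COST: eventually in `β`,
  `Re tr(e^{−βH} Δ_d P_S Δ_dᴴ) ≤ c L⁴ · Re tr(P_S e^{−βH})` — a chemical-potential-sign input: the image
  sector `(N−2, 0)` must not outweigh `(N, 0)`) ⇒ the frequent thermal sector bound with the same `c`.
* `dWaveGroundStateAverageLRO_of_sectorDuhamel` (target BODY, Theses-free in substance) and
  `birGappedPhaseReductionR_of_sectorDuhamel` (the item BY NAME, from the same data under `h2R h3`).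

Tasaki (2020) App. A for the β → ∞ endgame; Dyson–Lieb–Simon (1978) Thm. 3.1 for `b ≤ g`. [folklore]
-/

noncomputable section

namespace Summit.HubbardSuperconductivity.HubbardSuperconductivity.Theorems

open scoped Matrix.Norms.L2Operator ComplexOrder
open Matrix Filter MeasureTheory intervalIntegral
open Literature.MathematicalPhysics.QuantumLattice Literature.Hubbard
open Summit.HubbardSuperconductivity.HubbardSuperconductivity.Theses.BalabanIR

/-! ### The abstract step -/

/-- A trace that is invariant under `star` is the cast of its real part. -/
theorem trace_eq_ofReal_re_of_conjTranspose {n : Type*} [Fintype n] {X : Matrix n n ℂ}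
    (h : Xᴴ.trace = X.trace) : X.trace = ((X.trace.re : ℝ) : ℂ) := by
  rw [Matrix.trace_conjTranspose] at h
  exact (Complex.conj_eq_iff_re.mp h).symm

/-- **Equal-time sector pair correlation from the sector Duhamel function and the pair-removal cost
(abstract).** For a Hermitian `H`, an idempotent Hermitian `P` commuting with `H` with
`Z_P = Re tr(P e^{−βH}) > 0`, and any `B`: if `c₁ ≤ (∫₀¹ Re tr(P Bᴴ e^{−sβH} B e^{−(1−s)βH}) ds)/Z_P` and
`Re tr(e^{−βH} B P Bᴴ) ≤ c₂ Z_P`, then `2c₁ − c₂ ≤ Re( tr(P e^{−βH} BᴴB) / tr(P e^{−βH}) )`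
(DLS `b ≤ g` in the sector, `re_integral_trace_proj_duhamel_le`). [folklore] -/
theorem sector_equalTime_ge_of_duhamel_of_removalCost {n : Type*} [Fintype n] [DecidableEq n]
    {H P B : Matrix n n ℂ} (hH : H.IsHermitian) (hPP : P * P = P) (hPh : Pᴴ = P) (hPH : Commute P H)
    {β c₁ c₂ : ℝ} (hZ : 0 < (P * gibbsWeight β H).trace.re)
    (hD : c₁ ≤ (∫ s in (0:ℝ)..1, (P * Bᴴ * gibbsWeight (s * β) H * B *
        gibbsWeight ((1 - s) * β) H).trace.re) / (P * gibbsWeight β H).trace.re)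
    (hR : (gibbsWeight β H * (B * P * Bᴴ)).trace.re ≤ c₂ * (P * gibbsWeight β H).trace.re) :
    2 * c₁ - c₂ ≤ ((P * gibbsWeight β H * (Bᴴ * B)).trace / (P * gibbsWeight β H).trace).re := by
  have hPg : ∀ t : ℝ, P * gibbsWeight t H = gibbsWeight t H * P := fun t =>
    ((hPH.smul_right (-(t : ℂ))).exp_right).eq
  obtain ⟨-, hle⟩ := re_integral_trace_proj_duhamel_le hH hPP hPh hPg B β
  -- the hypothesis integrates real parts; the Literature bound takes the real part of the integral
  have hre : (∫ s in (0:ℝ)..1, (P * Bᴴ * gibbsWeight (s * β) H * B *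
      gibbsWeight ((1 - s) * β) H).trace.re) =
      (∫ s in (0:ℝ)..1, (P * Bᴴ * gibbsWeight (s * β) H * B *
        gibbsWeight ((1 - s) * β) H).trace).re := by
    have hi : IntervalIntegrable (fun s : ℝ => (P * Bᴴ * gibbsWeight (s * β) H * B *
        gibbsWeight ((1 - s) * β) H).trace) volume 0 1 :=
      (continuous_trace_duhamel_integrand β H (P * Bᴴ) B).intervalIntegrable 0 1
    have := Complex.reCLM.intervalIntegral_comp_comm hi
    simpa only [Complex.reCLM_apply] using this
  rw [hre, le_div_iff₀ hZ] at hD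
  -- the first equal-time trace is `tr(P e^{-βH} BᴴB)`
  have hT : (gibbsWeight β H * (P * (Bᴴ * B))).trace = (P * gibbsWeight β H * (Bᴴ * B)).trace := by
    rw [← Matrix.mul_assoc, ← hPg β]
  rw [hT] at hle
  -- both traces in the ratio are real
  have hW : (gibbsWeight β H)ᴴ = gibbsWeight β H := (isHermitian_gibbsWeight β hH).eq
  have hZr : (P * gibbsWeight β H).trace = (((P * gibbsWeight β H).trace.re : ℝ) : ℂ) := by
    refine trace_eq_ofReal_re_of_conjTranspose ?_
    rw [Matrix.conjTranspose_mul, hW, hPh, ← hPg β]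
  have hNr : (P * gibbsWeight β H * (Bᴴ * B)).trace =
      (((P * gibbsWeight β H * (Bᴴ * B)).trace.re : ℝ) : ℂ) := by
    refine trace_eq_ofReal_re_of_conjTranspose ?_
    rw [Matrix.conjTranspose_mul, Matrix.conjTranspose_mul, Matrix.conjTranspose_mul,
      Matrix.conjTranspose_conjTranspose, hW, hPh, Matrix.trace_mul_comm, ← hPg β, Matrix.mul_assoc]
  rw [hNr, hZr, ← Complex.ofReal_div, Complex.ofReal_re, le_div_iff₀ hZ]
  nlinarith

/-! ### The Hubbard instance in the route's frame -/

/-- **Sector-Duhamel pair order + pair-removal cost ⇒ the frequent thermal sector bound.**  In the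
route's frame (`H = hubbardTorus 2 L 1 U`, `S = (2⌊(1−δ)L²/2⌋, S^z = 0)`, `Δ_d = pairField dWaveFormFactor L`):
if for every `U` in a window, eventually in even `L`, (i) frequently in `β` the sector Duhamel pair order
`(∫₀¹ Re tr(P_S Δ_dᴴ e^{−sβH} Δ_d e^{−(1−s)βH}) ds)/Re tr(P_S e^{−βH}) ≥ c L⁴` (the typed transfer target
C⁺_A of card `form-factor-hs-ward-transfer`), and (ii) eventually in `β` the PAIR-REMOVAL COST bound
`Re tr(e^{−βH} Δ_d P_S Δ_dᴴ) ≤ c L⁴ Re tr(P_S e^{−βH})` (the image-sector term of DLS `b ≤ g`), then the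
frequent thermal EQUAL-TIME sector bound holds with the same `c` — the hypothesis of the landed endgame
`dWaveGroundStateAverageLRO_of_frequently_thermal`. [folklore] -/
theorem frequentlyThermal_of_sectorDuhamel
    (h : ∃ δ ∈ Set.Ioo (0:ℝ) (1/2), ∃ U₁ U₂ c : ℝ, 0 < U₁ ∧ U₁ < U₂ ∧ 0 < c ∧
      ∀ U ∈ Set.Ioo U₁ U₂, ∃ L₀ : ℕ, ∀ (L : ℕ) [NeZero L], L₀ ≤ L → Even L →
        let N : ℕ := 2 * ⌊(1 - δ) * (L : ℝ) ^ 2 / 2⌋₊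
        let H := hubbardTorus 2 L 1 U
        let S := szSector (Λ := FermionTorus 2 L) N 0
        let PS := projMatrix (S.map (Fock.toEuclidean (ι := Orb (FermionTorus 2 L)) :
          Fock (Orb (FermionTorus 2 L)) →ₗ[ℂ] EuclideanSpace ℂ (Finset (Orb (FermionTorus 2 L)))))
        let Δ := pairField dWaveFormFactor L
        (∃ᶠ β : ℝ in atTop, c * (L : ℝ) ^ 4 ≤
          (∫ s in (0:ℝ)..1, (PS * Δᴴ * gibbsWeight (s * β) H * Δ *
              gibbsWeight ((1 - s) * β) H).trace.re) / (PS * gibbsWeight β H).trace.re) ∧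
        (∀ᶠ β : ℝ in atTop, (gibbsWeight β H * (Δ * PS * Δᴴ)).trace.re ≤
          c * (L : ℝ) ^ 4 * (PS * gibbsWeight β H).trace.re)) :
    ∃ δ ∈ Set.Ioo (0:ℝ) (1/2), ∃ U₁ U₂ c : ℝ, 0 < U₁ ∧ U₁ < U₂ ∧ 0 < c ∧
      ∀ U ∈ Set.Ioo U₁ U₂, ∃ L₀ : ℕ, ∀ (L : ℕ) [NeZero L], L₀ ≤ L → Even L →
        let N : ℕ := 2 * ⌊(1 - δ) * (L : ℝ) ^ 2 / 2⌋₊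
        let H := hubbardTorus 2 L 1 U
        let S := szSector (Λ := FermionTorus 2 L) N 0
        let PS := projMatrix (S.map (Fock.toEuclidean (ι := Orb (FermionTorus 2 L)) :
          Fock (Orb (FermionTorus 2 L)) →ₗ[ℂ] EuclideanSpace ℂ (Finset (Orb (FermionTorus 2 L)))))
        ∃ᶠ β : ℝ in atTop, c * (L : ℝ) ^ 4 ≤
          ((PS * gibbsWeight β H *
              ((pairField dWaveFormFactor L)ᴴ * pairField dWaveFormFactor L)).trace /
            (PS * gibbsWeight β H).trace).re := by
  obtain ⟨δ, hδ, U₁, U₂, c, hU₁, hU₁₂, hc, h⟩ := h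
  refine ⟨δ, hδ, U₁, U₂, c, hU₁, hU₁₂, hc, fun U hU => ?_⟩
  obtain ⟨L₀, hL₀⟩ := h U hU
  refine ⟨L₀, fun L _ hL hLe => ?_⟩
  intro N H S PS
  obtain ⟨hfr, hev⟩ := hL₀ L hL hLe
  have hH : H.IsHermitian := LiebThm1.hamiltonian_isHermitian (fermionTorusGraph 2 L) 1 U
  have hinv : ∀ v ∈ S, H *ᵥ v ∈ S := fun v hv => szSector_invariant_hubbardTorus 2 L 1 U _ hv
  have hδ' : (-1 : ℝ) ≤ δ := by linarith [hδ.1]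
  have hS : S ≠ ⊥ := ne_bot_of_le_ne_bot
    (groundEigenspace_hubbardTorus_ne_bot 2 L 1 U (natFloor_density_le_card L δ hδ')) inf_le_left
  have hPH : Commute PS H := projMatrix_map_commute_of_invariant hH S hinv
  have hPP : PS * PS = PS := projMatrix_mul_self _
  have hPh : PSᴴ = PS := (projMatrix_isHermitian _).eq
  refine (hfr.and_eventually hev).mono fun β hβ => ?_
  have hZ : 0 < (PS * gibbsWeight β H).trace.re := re_trace_projMatrix_mul_gibbsWeight_pos hH S hinv hS β
  have key := sector_equalTime_ge_of_duhamel_of_removalCost hH hPP hPh hPH hZ hβ.1 hβ.2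
  linarith

/-- **Sector-Duhamel pair order + pair-removal cost ⇒ the target's BODY** (ground-state-average
`d_{x²−y²}` pair LRO on the window), by the landed β → ∞ endgame. Tasaki (2020) App. A. [folklore] -/
theorem dWaveGroundStateAverageLRO_of_sectorDuhamel
    (h : ∃ δ ∈ Set.Ioo (0:ℝ) (1/2), ∃ U₁ U₂ c : ℝ, 0 < U₁ ∧ U₁ < U₂ ∧ 0 < c ∧
      ∀ U ∈ Set.Ioo U₁ U₂, ∃ L₀ : ℕ, ∀ (L : ℕ) [NeZero L], L₀ ≤ L → Even L →
        let N : ℕ := 2 * ⌊(1 - δ) * (L : ℝ) ^ 2 / 2⌋₊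
        let H := hubbardTorus 2 L 1 U
        let S := szSector (Λ := FermionTorus 2 L) N 0
        let PS := projMatrix (S.map (Fock.toEuclidean (ι := Orb (FermionTorus 2 L)) :
          Fock (Orb (FermionTorus 2 L)) →ₗ[ℂ] EuclideanSpace ℂ (Finset (Orb (FermionTorus 2 L)))))
        let Δ := pairField dWaveFormFactor L
        (∃ᶠ β : ℝ in atTop, c * (L : ℝ) ^ 4 ≤
          (∫ s in (0:ℝ)..1, (PS * Δᴴ * gibbsWeight (s * β) H * Δ *
              gibbsWeight ((1 - s) * β) H).trace.re) / (PS * gibbsWeight β H).trace.re) ∧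
        (∀ᶠ β : ℝ in atTop, (gibbsWeight β H * (Δ * PS * Δᴴ)).trace.re ≤
          c * (L : ℝ) ^ 4 * (PS * gibbsWeight β H).trace.re)) :
    ∃ δ ∈ Set.Ioo (0:ℝ) (1/2), ∃ U₁ U₂ c : ℝ, 0 < U₁ ∧ U₁ < U₂ ∧ 0 < c ∧
      ∀ U ∈ Set.Ioo U₁ U₂, ∃ L₀ : ℕ, ∀ (L : ℕ) [NeZero L], L₀ ≤ L → Even L →
        let N : ℕ := 2 * ⌊(1 - δ) * (L : ℝ) ^ 2 / 2⌋₊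
        let H := hubbardTorus 2 L 1 U
        let S := szSector (Λ := FermionTorus 2 L) N 0
        let E₀ := S ⊓ Module.End.eigenspace (Matrix.toLin' H) ((H.minEnergyOn S : ℝ) : ℂ)
        let P := projMatrix (E₀.map (Fock.toEuclidean (ι := Orb (FermionTorus 2 L)) :
          Fock (Orb (FermionTorus 2 L)) →ₗ[ℂ] EuclideanSpace ℂ (Finset (Orb (FermionTorus 2 L)))))
        c * (L : ℝ) ^ 4 * P.trace.re ≤
          (P * ((pairField dWaveFormFactor L)ᴴ * pairField dWaveFormFactor L)).trace.re :=
  dWaveGroundStateAverageLRO_of_frequently_thermal (frequentlyThermal_of_sectorDuhamel h)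

/-- **The item BY NAME from the corrected sector-Duhamel transfer.** If, assuming the engine `2R` and
crux 3, one proves (sector Duhamel `d`-wave pair order ≥ `c L⁴` frequently in `β`) ∧ (pair-removal cost
`≤ c L⁴` eventually in `β`) on a window, eventually in even `L`, then `BirGappedPhaseReductionR` holds
(endgame `dWaveGroundStateAverageLRO_of_frequently_thermal`; `h2R`, `h3` are passed through, unused by the
glue itself). [folklore] -/
theorem birGappedPhaseReductionR_of_sectorDuhamel
    (h : BirComplexStableXYR → BirBdGPhaseCoercivity →
      ∃ δ ∈ Set.Ioo (0:ℝ) (1/2), ∃ U₁ U₂ c : ℝ, 0 < U₁ ∧ U₁ < U₂ ∧ 0 < c ∧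
      ∀ U ∈ Set.Ioo U₁ U₂, ∃ L₀ : ℕ, ∀ (L : ℕ) [NeZero L], L₀ ≤ L → Even L →
        let N : ℕ := 2 * ⌊(1 - δ) * (L : ℝ) ^ 2 / 2⌋₊
        let H := hubbardTorus 2 L 1 U
        let S := szSector (Λ := FermionTorus 2 L) N 0
        let PS := projMatrix (S.map (Fock.toEuclidean (ι := Orb (FermionTorus 2 L)) :
          Fock (Orb (FermionTorus 2 L)) →ₗ[ℂ] EuclideanSpace ℂ (Finset (Orb (FermionTorus 2 L)))))
        let Δ := pairField dWaveFormFactor L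
        (∃ᶠ β : ℝ in atTop, c * (L : ℝ) ^ 4 ≤
          (∫ s in (0:ℝ)..1, (PS * Δᴴ * gibbsWeight (s * β) H * Δ *
              gibbsWeight ((1 - s) * β) H).trace.re) / (PS * gibbsWeight β H).trace.re) ∧
        (∀ᶠ β : ℝ in atTop, (gibbsWeight β H * (Δ * PS * Δᴴ)).trace.re ≤
          c * (L : ℝ) ^ 4 * (PS * gibbsWeight β H).trace.re)) :
    BirGappedPhaseReductionR :=
  fun h2R h3 => dWaveGroundStateAverageLRO_of_frequently_thermal
    (frequentlyThermal_of_sectorDuhamel (h h2R h3))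

end Summit.HubbardSuperconductivity.HubbardSuperconductivity.Theorems

end
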